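import Literature.NumberTheory.ComplexMultiplication.CMOrderOverorderInvertibleIdealExtension
import Mathlib.RingTheory.ClassGroup.ExtendedHom
import HarnessLib

/-!
# `Pic(R) ↠ Pic(S)` for an over-order: Mathlib's `ClassGroup.extendedHom R T` is SURJECTIVE for
# `R ⊆ T ⊆ K = Frac R`, `T` integral over the one-dimensional noetherian `R`, and `#Pic(T) ∣ #Pic(R)`
# (Marseglia, *Computing the ideal class monoid of an order*, Remark 3.8, after Dade–Taussky–Zassenhaus)

Family `hodge`, lane `lit-hodgefound` (Track 2 foundations library; seat p15, row g26-#2), topic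
`Literature/NumberTheory/ComplexMultiplication`, namespaces `Literature.NumberTheory.ComplexMultiplication.NumberRing`
(§§1–2: any tower `R → T → K` of domains with common fraction field `K`; surjectivity for `T` integral over `R`,
both noetherian of dimension `≤ 1`), `…CMTypeLattice` (§3: the "arbitrary order" series
`𝔯 = endOrder (M_μ) ≤ S = endOrder (M_ν)`) and `…EndOrder` (§4: junction with the tree's
`ν = EndOrder.classGroupMap ρ : Pic(𝔯) → Cl(𝓞_K)` of `CMOrderPicardToClassGroup`).  THEOREMS ONLY: no definition,
no instance, no named fact (net Literature debt `0`).

`CMOrderOverorderInvertibleIdealExtension` (g26-#1) proved the statement at the level of IDEALS: every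
`J ∈ 𝓘(T)` is `I·T` with `I ∈ 𝓘(R)` (`NumberRing.unitsMap_extendedHom'_surjective`).  This file passes to the
Picard groups `Pic = 𝓘/𝓟`, which in Mathlib are `ClassGroup R = (FractionalIdeal R⁰ (FractionRing R))ˣ ⧸ 𝓟` with
the change-of-order map `ClassGroup.extendedHom R T` (`Mathlib.RingTheory.ClassGroup.ExtendedHom`, built over
`FractionRing R → FractionRing T`).  The work is the bookkeeping between the common field `K` of the series and
the two abstract fraction fields: `canonicalEquiv` along any `K →ₐ FractionRing ·` (§1).

## Sources, VERBATIM

S. Marseglia, *Computing the ideal class monoid of an order*, J. Lond. Math. Soc. (2) 101 (2020) 984–1007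
[Marseglia2019] (arXiv:1805.09671, held `paper:arxiv-1805.09671`):
* chunk p0006 (Remark 3.8): "Note that if `S` is an over-order of `R`, then the extension map `I ↦ IS` induces a
  surjective group homomorphism `Pic(R) ↠ Pic(S)`, see for example [dadetz62]. In particular, if `S = 𝒪_K` we
  have an exact sequence `0 → R^× → 𝒪_K^× → (𝒪_K/𝔣)^×/(R/𝔣)^× → Pic(R) → Pic(𝒪_K) → 0`".
* chunk p0013 (§6): "`I ↦ I𝒪_K` induces a surjective group homomorphism from `Pic(R)` to `Pic(𝒪_K)`, see
  Remark 3.8."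
Original: E. C. Dade, O. Taussky, H. Zassenhaus, Math. Ann. 148 (1962) 31–64 [DadeTausskyZassenhaus1962] (cited
through Marseglia's locator).  J. Neukirch, *Algebraic Number Theory* [NeukirchANT1999], Ch. I §12 Prop. (12.9)
p. 78: «the homomorphism `Pic(𝒪) → Cl_K`, `𝔞 ↦ 𝔞𝒪_K` is surjective» (the case `S = 𝒪_K`, in the tree as
`CMOrderPicardSurjective.classGroupMap_surjective`).

## What is formalised

* §1 `NumberRing.coe_canonicalEquiv_eq_map` (Mathlib's `canonicalEquiv` between two fraction fields is the
  push-forward along ANY algebra map between them), `extendedHom_fractionRing_canonicalEquiv` (extension commutes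
  with the passage `K → FractionRing ·`), **`classGroupExtendedHom_mk`**:
  `ClassGroup.extendedHom R T [I] = [I·T]` for `I ∈ 𝓘(R)` realised in the common field `K`.
* §2 **`NumberRing.classGroupExtendedHom_surjective`**: `Pic(R) → Pic(T)` is ONTO; **`natCard_classGroup_dvd`**:
  `#Pic(T) ∣ #Pic(R)`.
* §3 the order series: `CMTypeLattice.isTorsionFree_inclusion`, **`classGroupExtendedHom_inclusion_surjective`**,
  **`natCard_classGroup_dvd_of_le`** (`#Pic(S) ∣ #Pic(𝔯)` for every over-order `S = endOrder (M_ν) ⊇ 𝔯 = endOrder (M_μ)`).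
* §4 **`EndOrder.classGroupMap_eq_extendedHom`**: the tree's `ν` IS Mathlib's `ClassGroup.extendedHom 𝔯 𝓞_K` (under
  the `𝔯`-algebra structure `EndOrder.algebraRingOfIntegers`); with §2 this re-proves
  `CMOrderPicardSurjective.classGroupMap_surjective` by the local method (not restated).
-/

open scoped nonZeroDivisors NumberField
open Module FractionalIdeal NumberField

namespace Literature.NumberTheory.ComplexMultiplication

namespace NumberRing

/-! ## §1 `canonicalEquiv` along an algebra map; `ClassGroup.extendedHom R T [I] = [I·T]` in the common field -/

section Compatibility

/-- **Mathlib's `canonicalEquiv` between two localisations `P, P′` of `A` at `A ∖ 0` is the push-forward along ANY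
`A`-algebra map `g : P → P′`** (both are "the" fraction field; plumbing for reading `Pic` in the common field `K`).
[cite: Marseglia2019, §3 Remark 3.8 («the extension map `I ↦ IS`»), p. 6] -/
theorem coe_canonicalEquiv_eq_map {A : Type*} [CommRing A] {P P' : Type*} [CommRing P] [CommRing P']
    [Algebra A P] [Algebra A P'] [IsLocalization A⁰ P] [IsLocalization A⁰ P'] (g : P →ₐ[A] P')
    (J : FractionalIdeal A⁰ P) :
    ((canonicalEquiv A⁰ P P' J : FractionalIdeal A⁰ P') : Submodule A P') = (J : Submodule A P).map g.toLinearMap := by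
  have hfun : ∀ (h : A⁰ ≤ Submonoid.comap (RingHom.id A) A⁰) (y : P),
      IsLocalization.map P' (RingHom.id A) h y = g y := fun h y ↦
    RingHom.congr_fun (IsLocalization.ringHom_ext A⁰ (j := IsLocalization.map P' (RingHom.id A) h)
      (k := (g : P →+* P')) (by rw [IsLocalization.map_comp, RingHom.comp_id, AlgHom.comp_algebraMap])) y
  ext x
  rw [mem_coe, mem_canonicalEquiv_apply, Submodule.mem_map]
  constructor
  · rintro ⟨y, hy, rfl⟩
    exact ⟨y, hy, by rw [AlgHom.toLinearMap_apply, hfun]⟩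
  · rintro ⟨y, hy, rfl⟩
    exact ⟨y, hy, by rw [AlgHom.toLinearMap_apply, hfun]⟩

variable {R : Type*} [CommRing R] [IsDomain R] {T : Type*} [CommRing T] [IsDomain T] [Algebra R T]
  [Module.IsTorsionFree R T]
  {K : Type*} [Field K] [Algebra R K] [IsFractionRing R K] [Algebra T K] [IsFractionRing T K]
  [IsScalarTower R T K]

/-- **Extension commutes with the passage from the common field `K` to the abstract fraction fields**:
`(I ↦ I·T on FractionRing ·) ∘ canonicalEquiv_R = canonicalEquiv_T ∘ (I ↦ I·T inside K)` (plumbing for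
reading Mathlib's `ClassGroup.extendedHom` in `K`). [cite: Marseglia2019, §3 Remark 3.8, p. 6] -/
theorem extendedHom_fractionRing_canonicalEquiv (hf : R⁰ ≤ Submonoid.comap (algebraMap R T) T⁰)
    (I : FractionalIdeal R⁰ K) :
    FractionalIdeal.extendedHom (FractionRing T) T (canonicalEquiv R⁰ K (FractionRing R) I) =
      canonicalEquiv T⁰ K (FractionRing T) (I.extended K hf) := by
  set gR : K →ₐ[R] FractionRing R := ((FractionRing.algEquiv R K).symm : K →ₐ[R] FractionRing R) with hgR
  set gT : K →ₐ[T] FractionRing T := ((FractionRing.algEquiv T K).symm : K →ₐ[T] FractionRing T) with hgT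
  -- the two ring maps `K → FractionRing T` agree (both extend `R → T → FractionRing T`)
  have hcomp : (IsLocalization.map (FractionRing T) (algebraMap R T)
      (nonZeroDivisors_le_comap_nonZeroDivisors_of_injective _ (FaithfulSMul.algebraMap_injective R T)) :
        FractionRing R →+* FractionRing T).comp (gR : K →+* FractionRing R) = (gT : K →+* FractionRing T) :=
    IsLocalization.ringHom_ext R⁰ (by
      rw [RingHom.comp_assoc, AlgHom.comp_algebraMap, IsLocalization.map_comp, IsScalarTower.algebraMap_eq R T K,
        ← RingHom.comp_assoc, AlgHom.comp_algebraMap])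
  rw [← coeToSubmodule_inj]
  change ((extended (FractionRing T) _ (canonicalEquiv R⁰ K (FractionRing R) I) :
    FractionalIdeal T⁰ (FractionRing T)) : Submodule T (FractionRing T)) = _
  rw [coe_extended_eq_span, ← coeToSet_coeToSubmodule,
    coe_canonicalEquiv_eq_map gR, Submodule.map_coe, Set.image_image, coe_canonicalEquiv_eq_map gT,
    coe_extended_algebraMap_eq_span, Submodule.map_span]
  congr 1
  refine Set.image_congr' fun x ↦ ?_
  rw [AlgHom.toLinearMap_apply, AlgHom.toLinearMap_apply, ← RingHom.coe_coe gT, ← hcomp]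
  rfl

/-- **`ClassGroup.extendedHom R T [I] = [I·T]` for `I ∈ 𝓘(R)` realised inside the common fraction field `K`**
(Mathlib's change-of-order map on `Pic`, read on `K`-units; «the extension map `I ↦ IS` induces a … group
homomorphism `Pic(R) → Pic(S)`»). [cite: Marseglia2019, §3 Remark 3.8, p. 6] -/
theorem classGroupExtendedHom_mk (hf : R⁰ ≤ Submonoid.comap (algebraMap R T) T⁰) (I : (FractionalIdeal R⁰ K)ˣ) :
    ClassGroup.extendedHom R T (ClassGroup.mk K I) =
      ClassGroup.mk K (Units.map (extendedHom' (A := R) (K := K) K hf).toMonoidHom I) := by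
  rw [← ClassGroup.mk_canonicalEquiv K (FractionRing R) I, ClassGroup.extendedHom_mk,
    ← ClassGroup.mk_canonicalEquiv K (FractionRing T) (Units.map _ I)]
  congr 1
  apply Units.ext
  simp only [Units.coe_map, RingHom.toMonoidHom_eq_coe, MonoidHom.coe_coe]
  exact extendedHom_fractionRing_canonicalEquiv hf (I : FractionalIdeal R⁰ K)

end Compatibility

/-! ## §2 `Pic(R) → Pic(T)` is surjective; `#Pic(T) ∣ #Pic(R)` -/

section Surjective

variable {R : Type*} [CommRing R] [IsDomain R] {T : Type*} [CommRing T] [IsDomain T] [Algebra R T]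
  [Module.IsTorsionFree R T] [IsNoetherianRing R] [Ring.DimensionLEOne R] [IsNoetherianRing T]
  [Ring.DimensionLEOne T] [Algebra.IsIntegral R T]

/-- **MARSEGLIA REMARK 3.8 / DADE–TAUSSKY–ZASSENHAUS: «if `S` is an over-order of `R`, then the extension map
`I ↦ IS` induces a SURJECTIVE group homomorphism `Pic(R) ↠ Pic(S)`»** — for every tower `R → T → K` of
one-dimensional noetherian domains with common fraction field `K`, `T` integral over `R` (an order of a number
field and any over-order), with `Pic` = Mathlib's `ClassGroup` and the map = Mathlib's `ClassGroup.extendedHom`.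
Proof: every `J ∈ 𝓘(T)` is `I·T` with `I ∈ 𝓘(R)` (`CMOrderOverorderInvertibleIdealExtension`, the local method)
and `ClassGroup.extendedHom R T [I] = [I·T]` (§1). [cite: Marseglia2019, §3 Remark 3.8, p. 6]
[cite: DadeTausskyZassenhaus1962, (cited through Marseglia2019 Remark 3.8)] -/
theorem classGroupExtendedHom_surjective (K : Type*) [Field K] [Algebra R K] [IsFractionRing R K] [Algebra T K]
    [IsFractionRing T K] [IsScalarTower R T K] : Function.Surjective (ClassGroup.extendedHom R T) := by
  intro c
  refine ClassGroup.induction K (P := fun c ↦ ∃ a, ClassGroup.extendedHom R T a = c) (fun J ↦ ?_) c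
  have hf := nonZeroDivisors_le_comap_algebraMap (R := R) (T := T) K
  obtain ⟨I, hI⟩ := unitsMap_extendedHom'_surjective (K := K) hf J
  exact ⟨ClassGroup.mk K I, by rw [classGroupExtendedHom_mk hf, hI]⟩

/-- **`#Pic(T) ∣ #Pic(R)`**: the Picard number of an over-order divides that of the order (a surjection of
groups; with `CMOrderPicardFinite` both are finite for orders of number fields). [cite: Marseglia2019, §3 Remark
3.8, p. 6] [cite: DadeTausskyZassenhaus1962, (cited through Marseglia2019 Remark 3.8)] -/
theorem natCard_classGroup_dvd (K : Type*) [Field K] [Algebra R K] [IsFractionRing R K] [Algebra T K]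
    [IsFractionRing T K] [IsScalarTower R T K] : Nat.card (ClassGroup T) ∣ Nat.card (ClassGroup R) :=
  Subgroup.card_dvd_of_surjective _ (classGroupExtendedHom_surjective K)

end Surjective

end NumberRing

/-! ## §3 The arbitrary-order series: `𝔯 = endOrder (M_μ) ≤ S = endOrder (M_ν)` -/

namespace CMTypeLattice

variable {K : Type} [Field K] [NumberField K]
variable {ι : Type} [Fintype ι] [DecidableEq ι] (μ ν : Basis ι ℚ K)

/-- The over-order `S ⊇ 𝔯` is a torsion-free `𝔯`-module under the inclusion (plumbing: the hypothesis of Mathlib's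
`ClassGroup.extendedHom`). [cite: Marseglia2019, §2 («The fractional `R`-ideals that are rings are called
over-orders of `R`»), p. 4] -/
theorem isTorsionFree_inclusion (hle : endOrder (Algebra.leftMulMatrix μ) ≤ endOrder (Algebra.leftMulMatrix ν)) :
    letI : Algebra (endOrder (Algebra.leftMulMatrix μ)) (endOrder (Algebra.leftMulMatrix ν)) :=
      (Subring.inclusion hle).toAlgebra
    Module.IsTorsionFree (endOrder (Algebra.leftMulMatrix μ)) (endOrder (Algebra.leftMulMatrix ν)) :=
  letI : Algebra (endOrder (Algebra.leftMulMatrix μ)) (endOrder (Algebra.leftMulMatrix ν)) :=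
    (Subring.inclusion hle).toAlgebra
  Module.isTorsionFree_iff_algebraMap_injective.2 (Subring.inclusion_injective hle)

/-- **`Pic(𝔯) ↠ Pic(S)` for every over-order `S = endOrder (M_ν)` of the order `𝔯 = endOrder (M_μ)`** of a number
field `K` of any degree: Mathlib's `ClassGroup.extendedHom 𝔯 S` (for the `𝔯`-algebra structure of the inclusion)
is SURJECTIVE («the extension map `I ↦ IS` induces a surjective group homomorphism `Pic(R) ↠ Pic(S)`»).
[cite: Marseglia2019, §3 Remark 3.8, p. 6] [cite: DadeTausskyZassenhaus1962, (cited through Marseglia2019 Remark 3.8)] -/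
theorem classGroupExtendedHom_inclusion_surjective [Nonempty ι]
    (hle : endOrder (Algebra.leftMulMatrix μ) ≤ endOrder (Algebra.leftMulMatrix ν)) :
    letI : Algebra (endOrder (Algebra.leftMulMatrix μ)) (endOrder (Algebra.leftMulMatrix ν)) :=
      (Subring.inclusion hle).toAlgebra
    haveI := isTorsionFree_inclusion μ ν hle
    Function.Surjective
      (ClassGroup.extendedHom (endOrder (Algebra.leftMulMatrix μ)) (endOrder (Algebra.leftMulMatrix ν))) := by
  letI : Algebra (endOrder (Algebra.leftMulMatrix μ)) (endOrder (Algebra.leftMulMatrix ν)) :=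
    (Subring.inclusion hle).toAlgebra
  haveI := isTorsionFree_inclusion μ ν hle
  haveI := isFractionRing_endOrder (K := K) (Algebra.leftMulMatrix μ)
  haveI := isFractionRing_endOrder (K := K) (Algebra.leftMulMatrix ν)
  haveI := isNoetherianRing_endOrder (Algebra.leftMulMatrix μ)
  haveI := dimensionLEOne_endOrder (Algebra.leftMulMatrix μ)
  haveI := isNoetherianRing_endOrder (Algebra.leftMulMatrix ν)
  haveI := dimensionLEOne_endOrder (Algebra.leftMulMatrix ν)
  haveI : IsScalarTower (endOrder (Algebra.leftMulMatrix μ)) (endOrder (Algebra.leftMulMatrix ν)) K :=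
    IsScalarTower.of_algebraMap_eq (R := endOrder (Algebra.leftMulMatrix μ))
      (S := endOrder (Algebra.leftMulMatrix ν)) (A := K) fun _ ↦ rfl
  haveI : Algebra.IsIntegral (endOrder (Algebra.leftMulMatrix μ)) (endOrder (Algebra.leftMulMatrix ν)) :=
    ⟨isIntegral_inclusion μ ν hle⟩
  exact NumberRing.classGroupExtendedHom_surjective K

/-- **`#Pic(S) ∣ #Pic(𝔯)` for every over-order `S = endOrder (M_ν) ⊇ 𝔯 = endOrder (M_μ)`** (both finite:
`CMOrderIdealClassMonoidConductorDivisorSum.finite_classGroup_of_overorder`; the case `S = 𝓞_K`, `h_K ∣ #Pic(𝔯)`, is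
`CMOrderPicardSurjective.natCard_classGroup_dvd`). [cite: Marseglia2019, §3 Remark 3.8, p. 6]
[cite: DadeTausskyZassenhaus1962, (cited through Marseglia2019 Remark 3.8)] -/
theorem natCard_classGroup_dvd_of_le [Nonempty ι]
    (hle : endOrder (Algebra.leftMulMatrix μ) ≤ endOrder (Algebra.leftMulMatrix ν)) :
    Nat.card (ClassGroup (endOrder (Algebra.leftMulMatrix ν))) ∣
      Nat.card (ClassGroup (endOrder (Algebra.leftMulMatrix μ))) := by
  letI : Algebra (endOrder (Algebra.leftMulMatrix μ)) (endOrder (Algebra.leftMulMatrix ν)) :=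
    (Subring.inclusion hle).toAlgebra
  haveI := isTorsionFree_inclusion μ ν hle
  exact Subgroup.card_dvd_of_surjective _ (classGroupExtendedHom_inclusion_surjective μ ν hle)

end CMTypeLattice

/-! ## §4 Junction: the tree's `ν : Pic(𝔯) → Cl(𝓞_K)` is Mathlib's `ClassGroup.extendedHom` -/

namespace EndOrder

variable {K : Type} [Field K] [NumberField K]
variable {ι : Type} [Fintype ι] [DecidableEq ι] [Nonempty ι] (ρ : K →ₐ[ℚ] Matrix ι ι ℚ)
variable [IsFractionRing (endOrder ρ) K]

/-- **JUNCTION: Stevenhagen's `ν = classGroupMap ρ : Pic(𝔯) → Cl(𝒪)` (`CMOrderPicardToClassGroup`) IS Mathlib's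
`ClassGroup.extendedHom 𝔯 𝓞_K`** for the `𝔯`-algebra structure `algebraRingOfIntegers ρ` of `𝒪 = 𝓞_K`
(both are «`[I] ↦ [I·𝒪]`»). [cite: Stevenhagen2008NumberRings, §6 («the natural map `ν([I]) = [I·𝒪]`»), p. 224]
[cite: Marseglia2019, §3 Remark 3.8 and (3.1), p. 6] -/
theorem classGroupMap_eq_extendedHom :
    letI := algebraRingOfIntegers ρ
    classGroupMap ρ = ClassGroup.extendedHom (endOrder ρ) (𝓞 K) := by
  letI := algebraRingOfIntegers ρ
  refine MonoidHom.ext fun c ↦ ClassGroup.induction K (P := fun c ↦ classGroupMap ρ c = _) (fun I ↦ ?_) c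
  have hf := NumberRing.nonZeroDivisors_le_comap_algebraMap (R := endOrder ρ) (T := 𝓞 K) K
  have h2 : unitsExtend ρ I = Units.map (extendedHom' (A := endOrder ρ) (K := K) K hf).toMonoidHom I :=
    Units.ext rfl
  calc classGroupMap ρ (ClassGroup.mk K I) = ClassGroup.mk K (unitsExtend ρ I) := classGroupMap_mk ρ I
    _ = ClassGroup.mk K (Units.map (extendedHom' (A := endOrder ρ) (K := K) K hf).toMonoidHom I) := by rw [h2]
    _ = ClassGroup.extendedHom (endOrder ρ) (𝓞 K) (ClassGroup.mk K I) :=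
        (NumberRing.classGroupExtendedHom_mk hf I).symm

end EndOrder

end Literature.NumberTheory.ComplexMultiplication
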